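import Literature.AlgebraicGeometry.AbelianSchemes.PolarizationSymmetricWitness
import Literature.AlgebraicGeometry.AbelianSchemes.IsLambdaOfAtMulAdd
import HarnessLib

/-!
# A SYMMETRIC witness of `λ̄·λ̄` from any witness of `λ̄`: `E′ := E + (−1)^*E` (X1-D4)

Layer `Literature/AlgebraicGeometry/AbelianSchemes`, namespace `Literature.AlgebraicGeometry.AbelianSchemes.AbelianSchemeOver`.
THEOREMS ONLY.  Cell `hodgecm-mathlib`, HECKE-LINK (X-amp) plan of record (B-plan1 (g14) 21:50:29Z / 22:27:10Z), brick (X1-D):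
the symmetry clause `hEsym : ((−1)^*E) ∼ E` of ★ `exists_isAmple_isLambdaOfAt_of_symmetric_witnesses` (B-p15 (g10)).

For an abelian scheme `A/S` (reduced, locally Noetherian base; unit hypothesis `hD`), a dual pair `D`, an `S`-morphism
`λ : A → Â`, a geometric point `s` (`Ω` algebraically closed) and a witness `E` of `λ̄` at `s` (`IsLambdaOfAt`), the divisor
`E′ := E + (−1)^*E` is a witness of `λ̄·λ̄` — ★ `IsLambdaOfAt.classPullback_inv` («`(−1)^*` of a witness is a witness»,
[MumfordAV1970] §8 (iii)) and ★ `IsLambdaOfAt.mul_add` — and is SYMMETRIC on the nose: `(−1)^*E′ = (−1)^*E + (−1)^*(−1)^*E ∼ E′`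
since `(−1) ≫ (−1) = 𝟙` (★ `zsmulPt_neg_one_comp_self`).  Applied to the (X-amp-1) witness `E` of `λ̄_B²` (★
`exists_isLambdaOfAt_mul_self_of_graphPullback`) it yields a symmetric witness of `λ̄_B⁴`; Bezout then runs with `(c, 4) = 1`.
[MumfordAV1970] §8 (ii)–(iv); [MumfordFogartyKirwan1994] Ch. 6 §2 Def. 6.2–6.3.

HC_CM is proved only modulo the 7 printed citations until rung 0 closes; nothing here is about HC.

## References
* [MumfordAV1970] D. Mumford, *Abelian Varieties* (1970), §8 (ii)–(iv) (pp. 74–75).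
* [MumfordFogartyKirwan1994] D. Mumford, J. Fogarty, F. Kirwan, *Geometric Invariant Theory*, 3rd ed. (1994), Ch. 6 §2
  Definitions 6.2–6.3 (p. 120).
-/

noncomputable section

open CategoryTheory CategoryTheory.Limits AlgebraicGeometry MonoidalCategory
open scoped MonObj

universe u

namespace Literature.AlgebraicGeometry.AbelianSchemes

open Literature.AlgebraicGeometry.Motives Literature.AlgebraicGeometry.AbelianVarieties Literature.AlgebraicGeometry.Modules

namespace AbelianSchemeOver

variable {S : Scheme.{u}} (A : AbelianSchemeOver S) (D : A.DualPair) (lam : A.X ⟶ D.hat.X) {Ω : Type u} [Field Ω]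
  (s : Spec (.of Ω) ⟶ S)

/-- **`(−1) ≫ (−1) = 𝟙` on the underlying scheme of the fibre** (★ `zsmulPt_neg_one_comp_self`). [cite: MumfordAV1970, §8 (iii) (p. 75)] -/
theorem inv_left_comp_inv_left :
    (((𝟙 (A.fibre s).toAbelianVariety.X)⁻¹ : (A.fibre s).toAbelianVariety.X ⟶ (A.fibre s).toAbelianVariety.X)).left ≫
        (((𝟙 (A.fibre s).toAbelianVariety.X)⁻¹ : (A.fibre s).toAbelianVariety.X ⟶ (A.fibre s).toAbelianVariety.X)).left =
      𝟙 _ := by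
  rw [← Over.comp_left, ← (A.fibre s).toAbelianVariety.zsmulPt_neg_one_eq_inv,
    (A.fibre s).toAbelianVariety.zsmulPt_neg_one_comp_self, Over.id_left]

/-- **`E + (−1)^*E` is symmetric**: `(−1)^*(E + (−1)^*E) ∼ E + (−1)^*E` for every Cartier divisor `E` on the fibre `A_s`.
[cite: MumfordAV1970, §8 (iii) (p. 75)] -/
theorem classPullback_inv_add_classPullback_inv_linEquiv (E : CartierDivisor (A.fibre s).toAbelianVariety.X.left) :
    ((E + E.classPullback (((𝟙 (A.fibre s).toAbelianVariety.X)⁻¹ :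
        (A.fibre s).toAbelianVariety.X ⟶ (A.fibre s).toAbelianVariety.X)).left).classPullback
        (((𝟙 (A.fibre s).toAbelianVariety.X)⁻¹ : (A.fibre s).toAbelianVariety.X ⟶ (A.fibre s).toAbelianVariety.X)).left).LinEquiv
      (E + E.classPullback (((𝟙 (A.fibre s).toAbelianVariety.X)⁻¹ :
        (A.fibre s).toAbelianVariety.X ⟶ (A.fibre s).toAbelianVariety.X)).left) := by
  haveI : IsIso ((((𝟙 (A.fibre s).toAbelianVariety.X)⁻¹ :
      (A.fibre s).toAbelianVariety.X ⟶ (A.fibre s).toAbelianVariety.X)).left) := by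
    rw [← (A.fibre s).toAbelianVariety.zsmulPt_neg_one_eq_inv]; infer_instance
  rw [← CartierDivisor.cechClass_eq_iff_linEquiv, CartierDivisor.cechClass_classPullback, CartierDivisor.cechClass_add, map_mul,
    CartierDivisor.cechClass_classPullback, ← CechPic.pullback_comp,
    inv_left_comp_inv_left, CechPic.pullback_id_apply, mul_comm]

variable [IsReduced S] [IsLocallyNoetherian S]

/-- **A SYMMETRIC WITNESS OF `λ̄·λ̄` FROM ANY WITNESS OF `λ̄`**: if `λ̄ = Λ(𝒪(E))` at the geometric point `s` (`Ω` algebraically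
closed; unit hypothesis `hD`), then `E′ := E + (−1)^*E` satisfies `λ̄·λ̄ = Λ(𝒪(E′))` at `s` and `(−1)^*E′ ∼ E′` — ★
`IsLambdaOfAt.classPullback_inv` + ★ `IsLambdaOfAt.mul_add` + `(−1) ≫ (−1) = 𝟙`. [cite: MumfordAV1970, §8 (ii)–(iv) (pp. 74–75)]
[cite: MumfordFogartyKirwan1994, Ch. 6 §2 Definition 6.2–6.3 (p. 120)] -/
theorem IsLambdaOfAt.exists_symmetric_mul_self [IsAlgClosed Ω]
    (hD : Nonempty ((Scheme.Modules.pullback (DualPair.unitHatSlice D)).obj D.P ≅ SheafOfModules.unit _))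
    {E : CartierDivisor (A.fibre s).toAbelianVariety.X.left} (h : A.IsLambdaOfAt s D lam E) :
    ∃ E' : CartierDivisor (A.fibre s).toAbelianVariety.X.left, A.IsLambdaOfAt s D (lam * lam) E' ∧
      (E'.classPullback (((𝟙 (A.fibre s).toAbelianVariety.X)⁻¹ :
        (A.fibre s).toAbelianVariety.X ⟶ (A.fibre s).toAbelianVariety.X)).left).LinEquiv E' :=
  ⟨_, IsLambdaOfAt.mul_add A D s hD h (IsLambdaOfAt.classPullback_inv A D lam s h),
    A.classPullback_inv_add_classPullback_inv_linEquiv s E⟩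

/-- The same for the square of a homomorphism, in the `λ ^ 2 ↦ λ ^ 4` currency of the (X-amp) Bezout glue: a witness of `λ̄²`
yields a SYMMETRIC witness of `λ̄⁴` (`λ²·λ² = λ⁴`, Mathlib `pow_add`). [cite: MumfordAV1970, §8 (ii)–(iv) (pp. 74–75)]
[cite: MumfordFogartyKirwan1994, Ch. 6 §2 Definition 6.2–6.3 (p. 120)] -/
theorem IsLambdaOfAt.exists_symmetric_pow_four [IsAlgClosed Ω]
    (hD : Nonempty ((Scheme.Modules.pullback (DualPair.unitHatSlice D)).obj D.P ≅ SheafOfModules.unit _))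
    {E : CartierDivisor (A.fibre s).toAbelianVariety.X.left} (h : A.IsLambdaOfAt s D (lam ^ 2) E) :
    ∃ E' : CartierDivisor (A.fibre s).toAbelianVariety.X.left, A.IsLambdaOfAt s D (lam ^ 4) E' ∧
      (E'.classPullback (((𝟙 (A.fibre s).toAbelianVariety.X)⁻¹ :
        (A.fibre s).toAbelianVariety.X ⟶ (A.fibre s).toAbelianVariety.X)).left).LinEquiv E' := by
  have h4 : lam ^ 4 = lam ^ 2 * lam ^ 2 := by rw [← pow_add]
  rw [h4]
  exact IsLambdaOfAt.exists_symmetric_mul_self A D (lam ^ 2) s hD h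

end AbelianSchemeOver

end Literature.AlgebraicGeometry.AbelianSchemes

end
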